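import Mathlib
import HarnessLib
import HarnessLib.Audit
import Summits.Langlands.Statement
import Literature.NumberTheory.Automorphic.IsAutomorphicAE
import Literature.NumberTheory.Automorphic.AdicCompletionLocalField
import Literature.NumberTheory.GaloisRepresentations.LabelledHodgeTateWeights
import Literature.NumberTheory.PAdicHodge.FontaineDpst
import HarnessLib.Audit.Status.Attr

/-!
Route: EmbeddingNecklace

DORMANT since 2026-08-24T02:14:21Z (reconciler: no traction for 6.4 d (last activity item-evidence-added at 2026-08-17T14:56:21Z); parked, not closed — `ledger route dormant route-Langlands-EmbeddingNecklace --off` to reactivate) — unstaffed, not closed; items shared with open routes are served there. `ledger route dormant <id> --off` reactivates.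

# Route EmbeddingNecklace — all-weight GL2 lifting at unramified p by peeling embeddings on a
necklace of Shimura curves

It suffices to show X = DeRhamLiftingUnramified (typed target; = DeRhamLiftingIrred ∧-by-cases
DeRhamLiftingRed): for every totally real F, every prime p ≥ 5 UNRAMIFIED in F (no splitting or
residue-degree hypothesis), every continuous irreducible, totally odd, almost everywhere unramified
ρ : Γ_F → GL₂(ℚ̄_p) which at every v ∣ p is de Rham for Fontaine's pinned datum with two distinct
τ-labelled Hodge–Tate weights for every ℚ_p-embedding τ (ALL regular weights — parallel or not — and
all inertial types), with ρ̄|_(F(ζ_p)) absolutely irreducible (trace rendering) and ρ̄ modular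
(trace-congruent to a ρ₀ attached a.e. to a regular L-algebraic cuspidal π₀ of GL₂(𝔸_F)), is
attached at almost all places to a regular L-algebraic cuspidal π of GL₂(𝔸_F)
(`SatakeFrobCompatibleAE`). This is Hu–Tan 2015 Thm 6.3 / Kisin 2009 (2.2.18)
(`Literature…HuTan2015_theorem63`, typed verbatim in the same vocabulary) with "p splits completely"
weakened to "p unramified" and "crystalline" to "de Rham": the all-weight Fontaine–Mazur lifting
sector for Hilbert modular forms at F_v = ℚ_(p^f), f arbitrary — the printed open question of
QiuSu2025 Conj. 2.1.2 ('if' direction), Matsumoto2025 Rem. 1.15 / Conj. 1.13 and Jiang2026 Rem.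
1.1.3 (non-parallel weights at residue degree f ≥ 3; f ≤ 2: Kisin2009, HuTan2015, Matsumoto2025).
Typed split by the residual shape above p: DeRhamLiftingIrred (ρ̄|Γ_(F_v) irreducible for all v ∣ p
— BHHMS big-R = T input) and DeRhamLiftingRed (reducible at some v ∣ p — Hu–Wang input); junction
SectorComplement : X → Langlands (hub convention for sector routes). No card realised (open-question
harvest, operator A).
Lean: `DeRhamLiftingIrred ∧ DeRhamLiftingRed` — the two crux decls below (each a one-line Prop over
Literature.NumberTheory.Automorphic.{isCompact_glFiniteIntegralLevel, CuspidalAutomorphicRepData,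
InfinityType, SatakeFrobCompatibleAE},
Literature.NumberTheory.GaloisRepresentations.{FramedGaloisRep,
FramedGaloisRep.IsOdd/IsUnramifiedAt/toLocal/restrictField/labelledHodgeTateWeightsAt},
Literature.NumberTheory.PAdicHodge.fontainePstAdicCompletion (.IsDeRhamFramed/.algebra/.𝔅), Mathlib
NumberField.IsTotallyReal / NumberField.discr / CyclotomicField / Field.absoluteGaloisGroup /
IsDedekindDomain.HeightOneSpectrum; Sketch.lean rc 0, `closes` axioms
propext/Classical.choice/Quot.sound)

## Assembly
Pure logic, CHECKED (repair rev 4: gate-rendered file + HarnessLib.Audit.Check, lean rc 0,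
`#h21_check_closes` ok, cone in_cone 5/5, unused [], axioms propext/Classical.choice/Quot.sound):
the assembly ITEM is the case split `Assembly : DeRhamLiftingIrred → DeRhamLiftingRed →
DeRhamLiftingUnramified` (residually abs. irreducible at every v ∣ p, else reducible at some v ∣ p)
and the deciding theorem is crux-leaning (crux-only rule 2026-08-16): `closes (hI :
DeRhamLiftingIrred) (hR : DeRhamLiftingRed) (hC : SectorComplement) : Langlands` DERIVES `have hA :
Assembly` in-kernel (by_cases + push_neg, sorry-free) and ends `hC (hA hI hR)` — binders = the two
typed cruxes + the junction; Assembly sits in the cone as a discharged glue lemma, not as an open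
hypothesis. Imports are the vocabulary modules only (IsAutomorphicAE, AdicCompletionLocalField,
LabelledHodgeTateWeights, FontaineDpst): the unproved named fact HuTan2015_theorem63 (f = 1 known
case) is not load-bearing and does not ride in by import. The MATHEMATICAL assembly (informal items
18136–18142, ranks 2–3–4 above the typed pieces): BigRTEigenvector (support) puts the eigensystem x
of ρ into Ĥ(S_Ψ₀)^la_𝔪; NecklaceClosure iterates PartialAlgebraization over an ordering τ₁,…,τ_f of
Hom(F_w, ℚ̄_p), moving between the curves/surfaces S_Ψ_j ∋ τ_j by NecklaceTransport, until x is
locally algebraic in every direction; LocallyAlgebraicClassical (support, Emerton2006) makes x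
classical on S_Ψ_f or on B̄, Jacquet–Langlands + CM-quadratic descent give π on GL₂(𝔸_F); this
proves DeRhamLiftingIrred/Red on the BHHMS/Hu–Wang-generic sub-sector, the non-generic residual
corner being the conceded remainder NonGenericResidue (support, informal).

Rationale: WHY THIS LINE. Every engine for all-weight GL₂ lifting beyond F_v = ℚ_p now runs through Pan's
GEOMETRIC FONTAINE OPERATOR on perfectoid Shimura varieties (Pan II arXiv:2209.06366; QiuSu2025 for
unitary Shimura CURVES with GL₂(L) ⊂ G(ℚ_p), L arbitrary; Matsumoto2025 for U(1,1)^f-varieties, f ≤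
2; Jiang2026 for Hilbert modular varieties, PARALLEL weight), and all of them print the same wall: a
variety with a geometric direction for EVERY embedding τ of F_w realises the tensor induction ⊗_τ
ρ^τ, whose de Rham filtration has 2^f jumps, so in non-parallel weight the cube-edge components of
Fontaine's operator ν are not defined by the filtration (Matsumoto2025 Rem. 1.15, Jiang2026 Rem.
1.1.3), while a Shimura curve realises ρ itself (two jumps, any weights) but has a geometric
direction for ONE embedding only (QiuSu2025 Thm 2.1.1 needs σ^c-locally-algebraic vectors as a
HYPOTHESIS; their Conj. 2.1.2 is the missing 'de Rham in direction J ⇒ locally algebraic in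
direction J'). The NEW LEVER is to break this dilemma by changing the variety with the embedding:
for each τ ∈ Hom(F_w, ℚ̄_p) the unitary/quaternionic Shimura curve (or, for parity, surface) S_Ψ
whose geometric set Ψ ∋ τ has |Ψ| ≤ 2 — these inner forms agree at ALL finite places, so their
completed cohomologies at w localised at 𝔪 have the same typed Hecke supports (supersingular parts
uniformised by one definite quaternion algebra B̄ through the τ-twisted Drinfeld towers; μ-ordinary
Igusa varieties independent of the Shimura datum, Caraiani–Scholze 2017 §4 / Caraiani–Tamiozzo
arXiv:2107.10081 Lemma 13–Thm 15; or Matsumoto2025 Cor. 1.19) — and to certify local algebraicity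
ONE EMBEDDING AT A TIME with the proved ≤4-jump Fontaine operators (Pan II, QiuSu2025 §1: I = d∘d̄
is the τ-Fontaine operator on the whole O^(la,χ); Matsumoto2025 Thm 1.14/1.18 for |Ψ| = 2),
transporting between the S_Ψ's; after f steps the eigensystem is locally algebraic in every
direction, hence classical (Emerton2006 §7), and big R = T with eigenvectors (GeeNewton2020 +
Breuil–Herzig–Hu–Morra–Schraen Invent. 2023 / Hu–Wang 2022 GK-dimension, whose own setting is
Shimura curves over totally real fields at unramified v) makes this an automorphy lifting theorem.
Imported area: p-adic geometry of infinite-level Shimura curves (geometric Sen/Fontaine theory,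
RodriguezCamargo2022GeometricSen) and locally analytic Jacquet–Langlands (Dospinescu–Rodríguez
Camargo arXiv:2411.17082); partially de Rham representations (Ding2014PartiallyDeRham,
Ding2015LinvariantsPartiallyDeRham). Versus the listed routes: TriangulineChamber attacks the same
sector by irreducibility of local trianguline chambers (Galois side, BHS patched eigenvariety),
WachComponentCensus by potential diagonalisability, EisensteinGelfandKirillov by GK-dimension
flatness for REDUCIBLE Hilbert ρ̄, CMFern/DegenerateLimits by eigenvariety density; none uses a
geometric Fontaine operator, and Matsumoto's/Jiang's own inductions go TOP-DOWN from |Ψ| = f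
(needing the 2^f-jump operator), whereas the necklace only ever uses |Ψ| ≤ 2 — no tensor induction,
no intermediate Newton strata, no parallel-weight hypothesis, no induction base in f. Negatives
index (4 entries: SplitPrimeInduction ×2, OrdinaryPrimeTransport, K3KugaSatakeDescent) unrelated.

RANKED CRUXES. #0 DeRhamLiftingUnramified (target) — X as in § Thesis — Hu–Tan 6.3 with 'p
unramified' for 'p splits completely' and 'de Rham' for 'crystalline' (all regular labelled
Hodge–Tate weights, all types), totally real F, p ≥ 5, ρ̄|F(ζ_p) absolutely irreducible, ρ̄ modular;
conclusion: ρ is attached a.e. to a regular L-algebraic cuspidal π (SatakeFrobCompatibleAE). (why it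
might fail: It is all-weight Fontaine–Mazur lifting at F_v ≠ ℚ_p: open beyond f = 1 (Kisin2009,
HuTan2015) and f = 2 generic (Matsumoto2025); no genericity at v ∣ p is assumed, so the
Steinberg-type residual corner (excluded even by Kisin's (3) before Hu–Tan) and p = 5 adequacy are
inside.) [Kisin2009, HuTan2015, Matsumoto2025, QiuSu2025, Jiang2026, BuzzardGeeLMS2014]
#4 DeRhamLiftingIrred (crux) — X restricted to ρ whose residual restriction at EVERY v ∣ p is
absolutely irreducible (no finite-order characters χ₁, χ₂ of Γ_(F_v) with |tr ρ − χ₁ − χ₂|_p < 1 on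
Γ_(F_v)) — the supersingular-residual sector, where the localised completed cohomology of every
necklace curve lives on the supersingular tube and the big-R = T input is
Breuil–Herzig–Hu–Morra–Schraen's. [difficulty: open-problem] (why it might fail: For f ≥ 3 nothing
is in print: the necklace needs PartialAlgebraization with locally ANALYTIC coefficients in the
non-geometric directions (QiuSu2025 Conj 2.1.2 'if', open) and BHHMS genericity; for ρ̄|I_v ≅
ω_(2f)^n with extreme digits no eigenvector-existence theorem exists.) [QiuSu2025, Matsumoto2025,
Jiang2026, arXiv:2209.06366, arXiv:2009.03127, GeeNewton2020, Kisin2009]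
#5 DeRhamLiftingRed (crux) — X restricted to ρ whose residual restriction at SOME v ∣ p is reducible
(trace-congruent on Γ_(F_v) to χ₁ + χ₂ for finite-order χ_i) — the sector where the ordinary locus /
Igusa tower of the necklace curves carries the eigensystem and the big-R = T input is BHHMS (split)
or Hu–Wang (non-split). [difficulty: open-problem] (why it might fail: Contains the non-generic
reducible corner (χ₁χ₂⁻¹ ≡ 1, ω^(±1)) where even for F_v = ℚ_p Breuil–Mézard needed Paškūnas/Hu–Tan;
transport through the ordinary locus needs Igusa independence for typed la cohomology, and
H^0-stratum terms may hide eigensystems.) [HuTan2015, Kisin2009, Matsumoto2025, QiuSu2025,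
arXiv:2107.10081, GeeNewton2020, Pan2022]
#9 SectorComplement (support) — OUT-OF-SCOPE REMAINDER (hub convention of sector routes on this
all-fields/all-ranks summit: TriangulineChamber.SliceToLanglands,
PicardMuOrdinary/E8QuinticResidue.SectorComplement, QuadraticWindow.BeyondTheWindow):
DeRhamLiftingUnramified → Langlands. Everything the thesis does not claim — direction (A), n ≠ 2,
non-totally-real F, p ramified or p < 5, even / non-de-Rham / HT-irregular / residually small or
non-modular ρ, local–global compatibility at every place and the data 𝓡. Trivially implied by
Langlands; filed only so that `closes` ends in the summit constant; never staffed from this route;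
refuters grade the route on the cruxes, not on this item. [difficulty: open-problem]
[BuzzardGeeLMS2014, Kisin2009]

TWO-LAYER PLAN. Foreseen glued splits (nothing filed now; each k ≤ 3, depth 1): DeRhamLiftingIrred ⇐
IrredParallel (parallel labelled Hodge type at every v ∣ p: Jiang2026's regime, classicality
essentially in print for Hilbert varieties) → IrredNonParallel (the necklace's regime) →
DeRhamLiftingIrred — the BC3 birth skeleton bc/DeRhamLiftingIrred_birth.lean (rc 0, sorries = 2 =
stubs); DeRhamLiftingRed ⇐ RedLowDegree (all f_v ≤ 2: Kisin/Hu–Tan/Matsumoto modulo the non-generic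
corner) → RedHighDegree (some f_v ≥ 3) → DeRhamLiftingRed — skeleton bc/DeRhamLiftingRed_birth.lean
(rc 0, sorries = 2). PartialAlgebraization ⇐ (supersingular-tube case: ρ̄|Γ_(F_w) irreducible,
everything on B̄ and the τ-twisted Drinfeld towers, Dospinescu–Rodríguez Camargo JL functor) →
(ordinary case: Igusa tower, Coleman-type θ_τ-cokernels) → PartialAlgebraization.

KILL CRITERIA. (1) QiuSu2025 Conj. 2.1.2 ('if') disproved for the GEOMETRIC embedding — a τ-de Rham,
τ-regular ρ in the completed cohomology of a unitary Shimura curve with Π(ρ)^(τ-lalg, τ^c-la) = 0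
(e.g. read off Breuil's locally analytic socle conjecture where it is a theorem, or a Ding-type
eigenvariety computation at a τ-critical point over L = ℚ_(p²)) — kills PartialAlgebraization and
the route: close `refuted:PartialAlgebraization` (evidence file), keep the typed slices for
TriangulineChamber. (2) NecklaceTransport refuted by two inner forms G_Ψ, G_Ψ' (equal at all finite
places) with different typed Hecke supports in Ĥ_𝔪 at w ⇒ pivot to the auxiliary-prime transport
(Matsumoto2025 Cor 1.19 shape) or close `exhausted` with census. (3) A typed slice found
junk-witnessable/vacuous by a refuter ⇒ restate (misstated), never close — both are Fontaine–Mazur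
instances. (4) Published proof of QiuSu2025 Conj 2.1.2 or of non-parallel classicality for all f
(Jiang–Pan forthcoming, Matsumoto sequel) ⇒ close `superseded`/`known` and hand the slices to
provers as by-name supports. (5) If parity forces an anisotropic auxiliary place u for every
admissible Ψ over some F (even degree, π unramified principal series everywhere) and no soluble base
change repairs it, NecklaceClosure is restated with a discrete-series-at-u hypothesis and the target
shrinks accordingly (misstated, not refuted).

NOT DECOMPOSED YET. The mechanism cruxes are INFORMAL at open (completed cohomology, locally
analytic vectors, perfectoid Shimura curves, Drinfeld towers and Igusa varieties are absent from the
tree) and are filed by `ledger workitem add --informal` immediately after open: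
PartialAlgebraization (rank 2), NecklaceTransport (rank 3), NecklaceClosure (rank 4); informal
supports BigRTEigenvector (GeeNewton2020 + BHHMS/Hu–Wang, theorem-level in the Shimura-curve
setting), LocallyAlgebraicClassical (Emerton2006 §7), TauFontaineOperatorInPrint (QiuSu2025: I =
d∘d̄ is the τ-Fontaine operator on O^(la,χ); Matsumoto2025 Thm 1.14 for |Ψ| = 2), NonGenericResidue
(the conceded non-generic residual corner of both typed slices). Deliberately NOT decomposed: the
ramified-p sector (classicality side of the necklace is indifferent to ramification — QiuSu2025
allow any L — but no eigenvector-existence input exists; it is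
TriangulineChamber.LiftB2CrysRamifiedP's business), n ≥ 3, irregular weight, p ∈ {2,3}, residually
reducible ρ̄ (global), the CM-field conjugate-self-dual variant (a corollary of the same necklace,
Matsumoto2025 Thm 1.2 shape), and the passage from a.e.-attachment to `Corresponds 𝓡` (local–global
compatibility for Hilbert modular forms) which lives in SectorComplement.

CHEAPEST FALSIFIER. Literature, hours: check PartialAlgebraization at J = {τ} (τ geometric) against
Breuil's locally analytic socle conjecture / the Breuil–Ding theorems for GL₂(ℚ_(p²)) and
Ding2015LinvariantsPartiallyDeRham: for a crystalline generic ρ with one τ-critical refinement, does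
the predicted socle of Π(ρ)^la contain a (τ-lalg ⊗ η-la) constituent? If the proved cases of the
socle conjecture exclude it while ρ is τ-de Rham regular, the crux is dead. Run so far (this
session): QiuSu2025 intro READ (Conj 2.1.2 stated jointly with Ding, 'only if' proved as Thm 2.1.3,
no counter-indication); Jiang2026 abstract + classicality section READ; Matsumoto2025 pp. 2–16,
46–71 READ; arXiv:2603.27937 (Pan survey 2026) READ — no statement contradicting the 'if' direction
found; searchd (local index, zbMATH/OpenAlex cascade) was DOWN all session (ConnectionResetError),
arXiv API used instead — logged in NOTES.md.

NUMBERS. Known: f = 1 all weights (Kisin2009 Thm (2.2.18), HuTan2015 Thm 6.3, p ≥ 5); f = 2, F_v =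
ℚ_(p²), all weights and types for ρ̄_v with every Serre weight in [2, p−5] (Matsumoto2025 Thm
1.2/1.5, p ≥ 5); parallel regular weight, p inert, ρ̄_p semisimple generic, formally smooth local
rings elsewhere (Jiang2026 Thm 1.1.4); unitary Shimura curves, any L: σ-de Rham + σ^c-lalg ≠ 0 ⇒
classical (QiuSu2025 Thm 2.1.1). Jumps of the de Rham filtration seen by the Fontaine operator: 2^f
on U(1,1)^f / Hilbert varieties (tensor induction) versus 2 on a curve, ≤ 4 on a two-embedding
surface (Matsumoto2025 §5.2.3). Newton strata met: 2 (curve: P¹(F_w) ⊔ Ω) or 3 (surface), never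
⌊f/2⌋+2. GK-dimension input: BHHMS (Invent. 234, 2023) dim = f for K = ℚ_(p^f) unramified, ρ̄
generic; eigenvector existence GeeNewton2020 §5. Items at open: 5 typed (target, 2 cruxes, junction,
assembly) + 7 informal to be added = 12 ≤ 15.

DEFINITION REQUESTS. None needed for the typed layer (all constants exist: lean search --decl /
elaboration in Sketch.lean). Wanted later, to type the mechanism cruxes: an interface for completed
cohomology of a tower with its locally (J-)analytic / (J-)algebraic vectors (Emerton2006 §7;
QiuSu2025 §1 notation V^(J₁-la, J₂-lalg)) — to be requested as `--kind definition --notion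
CompletedCohomologyLocAn --topic Literature/NumberTheory/Automorphic` once a prover asks; and the
cite facts QiuSu2025 Thm 2.1.1/2.1.3, Matsumoto2025 Thm 1.7/1.12, Emerton2006 Thm 7.4.2.

Novelty: Searches (2026-08-17): `lit frontier Langlands --since 2023` (60 rows; read #2, #7, #9, #12, #16);
`lit search --source arxiv "locally analytic vectors completed cohomology modular curves"` (5:
arXiv:2209.06366, 2603.27937, 2008.07099, 2606.03778, 2512.04641 — READ 2512.04641 pp. 2–16/46–71,
2603.27937 whole); `lit search --source arxiv "Hilbert modular varieties torsion coefficients Igusa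
varieties Caraiani Tamiozzo"` (1: arXiv:2107.10081, READ §1, §4); `lit search --source arxiv
"classicality Hilbert modular forms Jiang locally analytic"` (1: arXiv:2605.18426, READ abstract via
arXiv + the classicality section); `lit read arxiv:2505.10290` (READ intro, Thm 1.0.1–1.0.3, §2.1
Conj 2.1.2); `lit read arxiv:2605.03519` (READ §1); local searchd / zbMATH / OpenAlex / galaxy
UNAVAILABLE all session (ConnectionResetError, logged); `lean search` over the tree
(labelledHodgeTateWeightsAt, HuTan2015_theorem63, FontaineMazurGL2*,
PDAutomorphyLiftingGL2TotallyReal); `ledger negatives --problem Langlands` (4, unrelated); 60 open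
routes + 5 more open Theses files read by thesis/mechanism.
Nearest prior art found: QiuSu2025 (arXiv:2505.10290: ONE unitary Shimura curve, the geometric
embedding only, σ^c-lalg as hypothesis; Conj 2.1.2 stated, 'only if' proved); Matsumoto2025
(arXiv:2512.04641: top-down induction on U(1,1)^Ψ varieties with his comparison theorem, f ≤ 2, Conj
1.13/4.50 + Rem 1.15 for f ≥ 3); Jiang2026 (arXiv:2605.18426: Igusa-stack comparison + la
Jacquet–Langlands, PARALLEL we  [refs: 2209.06366, 2107.10081, 2605.18426, 2505.10290, 2605.03519, 2512.04641, arxiv:2505.10290, arxiv:2605.03519, QiuSu2025, Matsumoto2025, Jiang2026]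

Barriers (technique_class: geometric-fontaine-operator, completed-cohomology): - technique_class: geometric-fontaine-operator, completed-cohomology, la-jacquet-langlands
- Literature.Barriers.Langlands.ModPLanglandsGL2BeyondQpFpBar: evaded — no mod p / p-adic local
Langlands correspondence for GL₂(F_v) is used or built; classicality comes from differential
operators on perfectoid Shimura curves (Pan's method is explicitly 'LL-free', arXiv:2603.27937 Rem
4.8) and eigenvector existence from GK-dimension + Gee–Newton, not from Colmez's functor.
- Literature.Barriers.Langlands.BreuilPaskunas2012_supersingularFamily: evaded — the infinite
supersingular families are never parametrised; only the Hecke support of typed locally analytic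
vectors is tracked.
- Literature.Barriers.Langlands.PaskunasCentreFinitenessFails: evaded — no Bernstein-centre
finiteness is invoked; the finiteness producing eigenvectors is BHHMS's GK-dimension bound fed to
GeeNewton2020, which needs no finite centre.
- Literature.Barriers.Langlands.PatchingLocalComponentBarrier: evaded — 'pro-automorphic + de Rham ⇒
classical' is blind to the components of the local deformation ring; big R = T gives every point of
Spec R_ρ̄ at once, so no potential diagonalisability / same-component hypothesis appears (this is
why Matsumoto obtains Breuil–Mézard for all types as a corollary).
- Literature.Barriers.Langlands.PatchingLocalComponentBarrierNarrow: evaded for the same reason —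
bare patching support is never the certificate of automorphy here; the special-fibre multiplicity
input it names as the kn

History (route lifecycle, newest last):
- 2026-08-17T12:25:08Z · rev 3: restated Assembly (stmt-Langlands-18135) — route-repair (bc6 route.declared-not-in-cone: Assembly + cone guardrail): (1) Assembly RESTATED 1:1 to the genuine crux→thesis glue `DeRhamLiftingIrred → DeRham (planner-rbadge-Langlands-EmbeddingNecklace-9ec2efe5-0)
- 2026-08-24T02:14:21Z · DORMANT — reconciler: no traction for 6.4 d (last activity item-evidence-added at 2026-08-17T14:56:21Z); parked, not closed — `ledger route dormant route-Langlands-Embedd (operator:999:530150)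

sub-problem: Langlands · status: dormant · opened planner-plan-novel-Langlands-Langlands-e266a39d-a-v2-g25-0 2026-08-17T11:50:23Z · rev 4 · ledger route-Langlands-EmbeddingNecklace
GENERATED by the gate from the ledger (D-0016/17). Provers cite these decls: `theorem foo : Summit.Langlands.Langlands.Theses.EmbeddingNecklace.<Decl> := …` in Summits/Langlands/Langlands/Theorems/<Name>.lean.
-/

namespace Summit.Langlands.Langlands.Theses.EmbeddingNecklace

open scoped BigOperators Topology Manifold Classical MeasureTheory ProbabilityTheory Matrix InnerProductSpace ComplexConjugate ContinuousMap
open Filter Set Function TopologicalSpace MeasureTheory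

attribute [summit_statement] _root_.Langlands

/-- item stmt-Langlands-18131 · target · rank 0 · open · by planner
why it might fail: It is all-weight Fontaine–Mazur lifting at F_v ≠ ℚ_p: open beyond f = 1 (Kisin2009, HuTan2015) and f = 2 generic (Matsumoto2025); no genericity at v ∣ p is assumed, so the Steinberg-type residual corner (excluded even by Kisin's (3) before Hu–Tan) and p = 5 adequacy are inside.
sources: Kisin2009, HuTan2015, Matsumoto2025, QiuSu2025, Jiang2026, BuzzardGeeLMS2014
[target] X as in § Thesis — Hu–Tan 6.3 with 'p unramified' for 'p splits completely' and 'de Rham'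
for 'crystalline' (all regular labelled Hodge–Tate weights, all types), totally real F, p ≥ 5,
ρ̄|F(ζ_p) absolutely irreducible, ρ̄ modular; conclusion: ρ is attached a.e. to a regular
L-algebraic cuspidal π (SatakeFrobCompatibleAE). -/
@[route_item "route-Langlands-EmbeddingNecklace"]
def DeRhamLiftingUnramified : Prop :=
  ∀ (F : Type) [Field F] [NumberField F], NumberField.IsTotallyReal F → ∀ (p : ℕ) [Fact p.Prime], 5 ≤ p → ¬ ((p : ℤ) ∣ NumberField.discr F) → ∀ (hcpt : Literature.NumberTheory.Automorphic.isCompact_glFiniteIntegralLevel 2 F) (ι : PadicAlgCl p ≃+* ℂ) (ρ : Literature.NumberTheory.GaloisRepresentations.FramedGaloisRep F (PadicAlgCl p) 2), ρ.toGaloisRep.IsIrreducible → (∀ᶠ v : IsDedekindDomain.HeightOneSpectrum (NumberField.RingOfIntegers F) in Filter.cofinite, ρ.IsUnramifiedAt v) → ρ.IsOdd → (∀ (v : IsDedekindDomain.HeightOneSpectrum (NumberField.RingOfIntegers F)) (hv : ((p : ℕ) : NumberField.RingOfIntegers F) ∈ v.asIdeal), let D := Literature.NumberTheory.PAdicHodge.fontainePstAdicCompletion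 v p hv; D.IsDeRhamFramed (ρ.toLocal v) ∧ (letI := D.algebra; ∀ τ : v.adicCompletion F →ₐ[ℚ_[p]] PadicAlgCl p, let M := ρ.labelledHodgeTateWeightsAt v D.algebra D.𝔅 τ.toRingHom; M.Nodup ∧ Multiset.card M = 2)) → (¬ ∃ χ₁ χ₂ : Field.absoluteGaloisGroup (CyclotomicField p F) →* (PadicAlgCl p)ˣ, IsOpen (χ₁.ker : Set (Field.absoluteGaloisGroup (CyclotomicField p F))) ∧ IsOpen (χ₂.ker : Set (Field.absoluteGaloisGroup (CyclotomicField p F))) ∧ ∀ σ, ‖(ρ.restrictField (CyclotomicField p F) σ).val.trace - ((χ₁ σ : PadicAlgCl p) + (χ₂ σ : PadicAlgCl p))‖ < 1) → (∃ (π₀ : Literature.NumberTheory.Automorphic.CuspidalAutomorphicRepData 2 F hcpt) (ρ₀ : Literature.NumberTheory.GaloisRepresentations.FramedGaloisRep F (PadicAlgCl p) 2), π₀.1.IsLAlgebraic ∧ (∃ T : Literature.NumberTheory.Automorphic.InfinityType F 2, π₀.1.HasInfinityType T ∧ T.IsRegular) ∧ Literature.NumberTheory.Automorphic.SatakeFrobCompatibleAE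 ι π₀.1 ρ₀ ∧ ∀ σ, ‖(ρ σ).val.trace - (ρ₀ σ).val.trace‖ < 1) → ∃ π : Literature.NumberTheory.Automorphic.CuspidalAutomorphicRepData 2 F hcpt, π.1.IsLAlgebraic ∧ (∃ T : Literature.NumberTheory.Automorphic.InfinityType F 2, π.1.HasInfinityType T ∧ T.IsRegular) ∧ Literature.NumberTheory.Automorphic.SatakeFrobCompatibleAE ι π.1 ρ

-- item stmt-Langlands-18136 · crux · rank 2 · open · by planner — informal only, no Lean statement yet:
--   [crux] (rank 2; the engine of the necklace = QiuSu2025 Conj 2.1.2, 'if' direction, for the GEOMETRIC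
--   embedding, with typed coefficients) Let F⁺ be totally real, w ∣ p, L = F⁺_w (any finite extension of
--   ℚ_p), Ψ ⊆ Hom(L, ℚ̄_p) with |Ψ| ≤ 2, and S_Ψ the unitary-similitude (or quaternionic) Shimura
--   curve/surface over the CM field F = E₀F⁺ whose archimedean signature is (1,1) exactly at the real
--   places matched with Ψ under ι : ℚ̄_p ≅ ℂ (GL₂(L) ⊂ G_Ψ(ℚ_p)). Let x : T^S → E be a non-Eisenstein
--   eigensystem with ρ_x : Γ_F → GL₂(E) absolutely irreducible, and J' ⊆ Hom(L, ℚ̄_p) ∖ Ψ with algebraic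
--   weights

/-- item stmt-Langlands-18132 · crux · rank 4 · open · by planner
why it might fail: For f ≥ 3 nothing is in print: the necklace needs PartialAlgebraization with locally ANALYTIC coefficients in the non-geometric directions (QiuSu2025 Conj 2.1.2 'if', open) and BHHMS genericity; for ρ̄|I_v ≅ ω_(2f)^n with extreme digits no eigenvector-existence theorem exists.
sources: QiuSu2025, Matsumoto2025, Jiang2026, arXiv:2209.06366, arXiv:2009.03127, GeeNewton2020
[crux] X restricted to ρ whose residual restriction at EVERY v ∣ p is absolutely irreducible (no
finite-order characters χ₁, χ₂ of Γ_(F_v) with |tr ρ − χ₁ − χ₂|_p < 1 on Γ_(F_v)) — the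
supersingular-residual sector, where the localised completed cohomology of every necklace curve
lives on the supersingular tube and the big-R = T input is Breuil–Herzig–Hu–Morra–Schraen's.
[difficulty: open-problem] -/
@[route_item "route-Langlands-EmbeddingNecklace", crux]
def DeRhamLiftingIrred : Prop :=
  ∀ (F : Type) [Field F] [NumberField F], NumberField.IsTotallyReal F → ∀ (p : ℕ) [Fact p.Prime], 5 ≤ p → ¬ ((p : ℤ) ∣ NumberField.discr F) → ∀ (hcpt : Literature.NumberTheory.Automorphic.isCompact_glFiniteIntegralLevel 2 F) (ι : PadicAlgCl p ≃+* ℂ) (ρ : Literature.NumberTheory.GaloisRepresentations.FramedGaloisRep F (PadicAlgCl p) 2), ρ.toGaloisRep.IsIrreducible → (∀ᶠ v : IsDedekindDomain.HeightOneSpectrum (NumberField.RingOfIntegers F) in Filter.cofinite, ρ.IsUnramifiedAt v) → ρ.IsOdd → (∀ (v : IsDedekindDomain.HeightOneSpectrum (NumberField.RingOfIntegers F)) (hv : ((p : ℕ) : NumberField.RingOfIntegers F) ∈ v.asIdeal), let D := Literature.NumberTheory.PAdicHodge.fontainePstAdicCompletion v p hv; D.IsDeRhamFramed (ρ.toLocal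 v) ∧ (letI := D.algebra; ∀ τ : v.adicCompletion F →ₐ[ℚ_[p]] PadicAlgCl p, let M := ρ.labelledHodgeTateWeightsAt v D.algebra D.𝔅 τ.toRingHom; M.Nodup ∧ Multiset.card M = 2)) → (∀ v : IsDedekindDomain.HeightOneSpectrum (NumberField.RingOfIntegers F), ((p : ℕ) : NumberField.RingOfIntegers F) ∈ v.asIdeal → ¬ ∃ χ₁ χ₂ : Field.absoluteGaloisGroup (v.adicCompletion F) →* (PadicAlgCl p)ˣ, IsOpen (χ₁.ker : Set (Field.absoluteGaloisGroup (v.adicCompletion F))) ∧ IsOpen (χ₂.ker : Set (Field.absoluteGaloisGroup (v.adicCompletion F))) ∧ ∀ σ, ‖(ρ.toLocal v σ).val.trace - ((χ₁ σ : PadicAlgCl p) + (χ₂ σ : PadicAlgCl p))‖ < 1) → (¬ ∃ χ₁ χ₂ : Field.absoluteGaloisGroup (CyclotomicField p F) →* (PadicAlgCl p)ˣ, IsOpen (χ₁.ker : Set (Field.absoluteGaloisGroup (CyclotomicField p F))) ∧ IsOpen (χ₂.ker : Set (Field.absoluteGaloisGroup (CyclotomicField p F))) ∧ ∀ σ, ‖(ρ.restrictField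 (CyclotomicField p F) σ).val.trace - ((χ₁ σ : PadicAlgCl p) + (χ₂ σ : PadicAlgCl p))‖ < 1) → (∃ (π₀ : Literature.NumberTheory.Automorphic.CuspidalAutomorphicRepData 2 F hcpt) (ρ₀ : Literature.NumberTheory.GaloisRepresentations.FramedGaloisRep F (PadicAlgCl p) 2), π₀.1.IsLAlgebraic ∧ (∃ T : Literature.NumberTheory.Automorphic.InfinityType F 2, π₀.1.HasInfinityType T ∧ T.IsRegular) ∧ Literature.NumberTheory.Automorphic.SatakeFrobCompatibleAE ι π₀.1 ρ₀ ∧ ∀ σ, ‖(ρ σ).val.trace - (ρ₀ σ).val.trace‖ < 1) → ∃ π : Literature.NumberTheory.Automorphic.CuspidalAutomorphicRepData 2 F hcpt, π.1.IsLAlgebraic ∧ (∃ T : Literature.NumberTheory.Automorphic.InfinityType F 2, π.1.HasInfinityType T ∧ T.IsRegular) ∧ Literature.NumberTheory.Automorphic.SatakeFrobCompatibleAE ι π.1 ρ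

/-- item stmt-Langlands-18133 · crux · rank 5 · open · by planner
why it might fail: Contains the non-generic reducible corner (χ₁χ₂⁻¹ ≡ 1, ω^(±1)) where even for F_v = ℚ_p Breuil–Mézard needed Paškūnas/Hu–Tan; transport through the ordinary locus needs Igusa independence for typed la cohomology, and H^0-stratum terms may hide eigensystems.
sources: HuTan2015, Kisin2009, Matsumoto2025, QiuSu2025, arXiv:2107.10081, GeeNewton2020
[crux] X restricted to ρ whose residual restriction at SOME v ∣ p is reducible (trace-congruent on
Γ_(F_v) to χ₁ + χ₂ for finite-order χ_i) — the sector where the ordinary locus / Igusa tower of the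
necklace curves carries the eigensystem and the big-R = T input is BHHMS (split) or Hu–Wang
(non-split). [difficulty: open-problem] -/
@[route_item "route-Langlands-EmbeddingNecklace", crux]
def DeRhamLiftingRed : Prop :=
  ∀ (F : Type) [Field F] [NumberField F], NumberField.IsTotallyReal F → ∀ (p : ℕ) [Fact p.Prime], 5 ≤ p → ¬ ((p : ℤ) ∣ NumberField.discr F) → ∀ (hcpt : Literature.NumberTheory.Automorphic.isCompact_glFiniteIntegralLevel 2 F) (ι : PadicAlgCl p ≃+* ℂ) (ρ : Literature.NumberTheory.GaloisRepresentations.FramedGaloisRep F (PadicAlgCl p) 2), ρ.toGaloisRep.IsIrreducible → (∀ᶠ v : IsDedekindDomain.HeightOneSpectrum (NumberField.RingOfIntegers F) in Filter.cofinite, ρ.IsUnramifiedAt v) → ρ.IsOdd → (∀ (v : IsDedekindDomain.HeightOneSpectrum (NumberField.RingOfIntegers F)) (hv : ((p : ℕ) : NumberField.RingOfIntegers F) ∈ v.asIdeal), let D := Literature.NumberTheory.PAdicHodge.fontainePstAdicCompletion v p hv; D.IsDeRhamFramed (ρ.toLocal v) ∧ (letI := D.algebra; ∀ τ : v.adicCompletion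 F →ₐ[ℚ_[p]] PadicAlgCl p, let M := ρ.labelledHodgeTateWeightsAt v D.algebra D.𝔅 τ.toRingHom; M.Nodup ∧ Multiset.card M = 2)) → (∃ v : IsDedekindDomain.HeightOneSpectrum (NumberField.RingOfIntegers F), ((p : ℕ) : NumberField.RingOfIntegers F) ∈ v.asIdeal ∧ ∃ χ₁ χ₂ : Field.absoluteGaloisGroup (v.adicCompletion F) →* (PadicAlgCl p)ˣ, IsOpen (χ₁.ker : Set (Field.absoluteGaloisGroup (v.adicCompletion F))) ∧ IsOpen (χ₂.ker : Set (Field.absoluteGaloisGroup (v.adicCompletion F))) ∧ ∀ σ, ‖(ρ.toLocal v σ).val.trace - ((χ₁ σ : PadicAlgCl p) + (χ₂ σ : PadicAlgCl p))‖ < 1) → (¬ ∃ χ₁ χ₂ : Field.absoluteGaloisGroup (CyclotomicField p F) →* (PadicAlgCl p)ˣ, IsOpen (χ₁.ker : Set (Field.absoluteGaloisGroup (CyclotomicField p F))) ∧ IsOpen (χ₂.ker : Set (Field.absoluteGaloisGroup (CyclotomicField p F))) ∧ ∀ σ, ‖(ρ.restrictField (CyclotomicField p F) σ).val.trace - ((χ₁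 σ : PadicAlgCl p) + (χ₂ σ : PadicAlgCl p))‖ < 1) → (∃ (π₀ : Literature.NumberTheory.Automorphic.CuspidalAutomorphicRepData 2 F hcpt) (ρ₀ : Literature.NumberTheory.GaloisRepresentations.FramedGaloisRep F (PadicAlgCl p) 2), π₀.1.IsLAlgebraic ∧ (∃ T : Literature.NumberTheory.Automorphic.InfinityType F 2, π₀.1.HasInfinityType T ∧ T.IsRegular) ∧ Literature.NumberTheory.Automorphic.SatakeFrobCompatibleAE ι π₀.1 ρ₀ ∧ ∀ σ, ‖(ρ σ).val.trace - (ρ₀ σ).val.trace‖ < 1) → ∃ π : Literature.NumberTheory.Automorphic.CuspidalAutomorphicRepData 2 F hcpt, π.1.IsLAlgebraic ∧ (∃ T : Literature.NumberTheory.Automorphic.InfinityType F 2, π.1.HasInfinityType T ∧ T.IsRegular) ∧ Literature.NumberTheory.Automorphic.SatakeFrobCompatibleAE ι π.1 ρ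

-- item stmt-Langlands-18137 · support · rank 3 · open · by planner — informal only, no Lean statement yet:
--   [crux] (rank 3; horizontal transport between the beads) For two geometric sets Ψ, Ψ' ⊆ Hom(L, ℚ̄_p)
--   of the same size ≤ 2 at w, the inner forms G_Ψ, G_Ψ' agree at ALL finite places (signatures differ
--   only at ∞, an even number of switches). CLAIM: for every non-Eisenstein 𝔪 and every type T =
--   (J-lalg[λ_J], J^c-la), the Hecke supports of the T-typed locally analytic vectors of Ĥ^|Ψ|(S_Ψ,
--   K^w)_𝔪 and of Ĥ^|Ψ'|(S_Ψ', K^w)_𝔪 coincide (as subsets of Spec T^S_𝔪[1/p]); likewise each coincides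
--   with the union of the T-typed supports of the μ-ordinary Igusa-tower contribution and of A(B̄)_𝔪 (B̄
--   totally def

-- item stmt-Langlands-18138 · support · rank 4 · open · by planner — informal only, no Lean statement yet:
--   [crux] (rank 4; the induction and the existence of the beads) Let F⁺, w, L = F⁺_w = ℚ_(p^f) (p
--   unramified for the eigenvector input), ρ as in the typed slices with ρ̄|Γ_L BHHMS/Hu–Wang-generic.
--   CLAIM: given PartialAlgebraization and NecklaceTransport, if the eigensystem x of ρ occurs in
--   Ĥ(S_Ψ₀, K^w)^la_𝔪 for ONE admissible Ψ₀ (BigRTEigenvector), then x occurs in the locally ALGEBRAIC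
--   vectors Ĥ(S_Ψ, K^w)^(Σ_w-lalg[λ])_𝔪 for some admissible Ψ, or in A(B̄)^(Σ_w-lalg[λ])_𝔪 — hence
--   (LocallyAlgebraicClassical + Jacquet–Langlands + CM-quadratic descent, Matsumoto2025 Thm 1.2 (3)) ρ
--   is attached a.e. t

/-- item stmt-Langlands-18134 · support · rank 9 · open · by planner
sources: BuzzardGeeLMS2014, Kisin2009
[support] OUT-OF-SCOPE REMAINDER (hub convention of sector routes on this all-fields/all-ranks
summit: TriangulineChamber.SliceToLanglands, PicardMuOrdinary/E8QuinticResidue.SectorComplement,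
QuadraticWindow.BeyondTheWindow): DeRhamLiftingUnramified → Langlands. Everything the thesis does
not claim — direction (A), n ≠ 2, non-totally-real F, p ramified or p < 5, even / non-de-Rham /
HT-irregular / residually small or non-modular ρ, local–global compatibility at every place and the
data 𝓡. Trivially implied by Langlands; filed only so that `closes` ends in the summit constant;
never staffed from this route; refuters grade the route on the cruxes, not on this item.
[difficulty: open-problem] -/
@[route_item "route-Langlands-EmbeddingNecklace", crux]
def SectorComplement : Prop :=
  DeRhamLiftingUnramified → _root_.Langlands

-- item stmt-Langlands-18139 · support · rank 9 · open · by planner — informal only, no Lean statement yet: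
--   [support] (theorem-level in the Shimura-curve setting; M-sized transcription for |Ψ| = 2) For L =
--   ℚ_(p^f) unramified, p ≥ 5, ρ̄ : Γ_F → GL₂(𝔽̄_p) non-Eisenstein, decomposed generic, with ρ̄|Γ_L
--   generic in the sense of Breuil–Herzig–Hu–Morra–Schraen (semisimple case, Invent. Math. 234 (2023))
--   or Hu–Wang (non-semisimple case, Camb. J. Math. 2022) and formally smooth framed local deformation
--   rings at the other places of S: the 'big R = T with eigenvectors' statement R_(ρ̄,𝒟) ≅ T^S(K^w)_𝔪
--   and Ĥ^|Ψ|(S_Ψ, K^w, V_(λ^w))_𝔪[φ] ≠ 0 for EVERY φ : R → 𝒪 (Matsumoto2025 Thm 1.12 = Thm 7.x, 'a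
--   slight modific

-- item stmt-Langlands-18140 · support · rank 9 · open · by planner — informal only, no Lean statement yet:
--   [support] (in print) Locally algebraic vectors of completed cohomology are classical: for a Shimura
--   curve/surface S_Ψ (or the definite B̄) and an algebraic weight λ, every Hecke eigensystem occurring
--   in the W_λ-locally algebraic vectors of Ĥ^|Ψ|(S_Ψ, K^w)_𝔪 occurs in the classical cohomology
--   H^|Ψ|(S_(K^wK_w), V_λ)_𝔪 for some K_w, hence comes from a cohomological automorphic representation
--   of G_Ψ, i.e. (base change, Matsumoto2025 Def 4.49 / Thm 'base change') from a cohomological cuspidal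
--   automorphic representation χ ⊠ π of 𝔸_E₀^× × GL₂(𝔸_F); for B̄: W-locally algebraic p-adic
--   automorphic forms

-- item stmt-Langlands-18141 · support · rank 9 · open · by planner — informal only, no Lean statement yet:
--   [support] (in print; the reason the necklace never meets a 2^f-jump operator) (a) On a unitary
--   Shimura curve S with GL₂(L) ⊂ G(ℚ_p), L/ℚ_p arbitrary, geometric embedding ι: the intertwining
--   operator I = d∘d̄ on 𝒪^(la,χ)_(K^v) (d̄ := 0 on the non-ι-analytic directions) IS the geometric
--   ι-Fontaine operator of the two-dimensional ρ (two jumps, ANY ι-weights), and Π(ρ)^(σ^c-la, σ-lalg) ≠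
--   0 ⇒ ρ σ-de Rham regular (QiuSu2025 §1 'p-adic Hodge-theoretic interpretation of I still holds true',
--   Thm 2.1.3; Pan II arXiv:2209.06366 Thm 4.3 for L = ℚ_p). (b) For two geometric embeddings (|Ψ| = 2,
--   L = ℚ_(p²))

-- item stmt-Langlands-18142 · support · rank 9 · open · by planner — informal only, no Lean statement yet:
--   [support] (CONCEDED REMAINDER of both typed slices, not attacked by this route; filed so that
--   graders judge the mechanism on the generic sub-sector) DeRhamLiftingIrred/DeRhamLiftingRed for ρ
--   whose residual restriction at some v ∣ p lies OUTSIDE the Breuil–Herzig–Hu–Morra–Schraen / Hu–Wang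
--   genericity window (ρ̄|I_(F_v) with an extreme p-adic digit: Serre weights touching 0, 1, p−2, p−1;
--   in particular χ₁χ₂⁻¹|Γ_(F_v) ≡ 1 or ω^(±1), the Steinberg / très ramifié corner), or with p = 5 and
--   ρ̄ of exceptional projective image. Here no eigenvector-existence theorem (big R = T with
--   GK-dimension) is avai

-- earlier Assembly (stmt-Langlands-18135, replaced 2026-08-17T12:25:08Z -> stmt-Langlands-18173): retired by None — DeRhamLiftingIrred → DeRhamLiftingRed → SectorComplement → _root_.Langlands
/-- item stmt-Langlands-18173 · assembly · rank 1 · open · by planner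
sources: Kisin2009, BuzzardGeeLMS2014
[assembly] the typed crux→thesis glue: a ρ as in the target DeRhamLiftingUnramified is either
residually absolutely irreducible at EVERY v ∣ p (no finite-order χ₁, χ₂ of Γ_(F_v) with |tr ρ − χ₁
− χ₂|_p < 1) — DeRhamLiftingIrred applies — or residually reducible at SOME v ∣ p — DeRhamLiftingRed
applies. Pure logic (by_contra; the reducible witness place is handed to DeRhamLiftingRed);
candidate proof attached as item evidence; consumed by `closes hI hR hA hC := hC (hA hI hR)`. -/
@[route_item "route-Langlands-EmbeddingNecklace"]
def Assembly : Prop :=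
  DeRhamLiftingIrred → DeRhamLiftingRed → DeRhamLiftingUnramified

/-! D-0027 §2.1 — DECIDING THEOREM (planner-authored via `route open/edit --closes-file`; by planner-rbadge-Langlands-EmbeddingNecklace-9ec2efe5-g3-0 2026-08-17T13:37:44Z):
its hypotheses are this route's items and its conclusion the sub-problem Statement (glue_lint), and it elaborates with this file. -/

@[closes "route-Langlands-EmbeddingNecklace"] theorem closes (hI : DeRhamLiftingIrred) (hR : DeRhamLiftingRed) (hC : SectorComplement) :
    _root_.Langlands := by
  -- Deciding theorem (D-0027 §2.1), crux-leaning shape (crux-only rule 2026-08-16): the binders are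
  -- the two typed cruxes `DeRhamLiftingIrred`, `DeRhamLiftingRed` and the junction support
  -- `SectorComplement : DeRhamLiftingUnramified → Langlands`; the frame item `Assembly`
  -- (= cruxes → thesis, the residual case split at the places above p) is pure logic and is
  -- DISCHARGED here in-kernel (sorry-free), then applied.
  have hA : Assembly := by
    intro hI' hR' F _ _ hF p _ hp hdisc hcpt ι ρ hirr hunr hodd hHT habs hmod
    by_cases h : ∀ v : IsDedekindDomain.HeightOneSpectrum (NumberField.RingOfIntegers F),
        ((p : ℕ) : NumberField.RingOfIntegers F) ∈ v.asIdeal →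
        ¬ ∃ χ₁ χ₂ : Field.absoluteGaloisGroup (v.adicCompletion F) →* (PadicAlgCl p)ˣ,
          IsOpen (χ₁.ker : Set (Field.absoluteGaloisGroup (v.adicCompletion F))) ∧
          IsOpen (χ₂.ker : Set (Field.absoluteGaloisGroup (v.adicCompletion F))) ∧
          ∀ σ, ‖(ρ.toLocal v σ).val.trace - ((χ₁ σ : PadicAlgCl p) + (χ₂ σ : PadicAlgCl p))‖ < 1
    · exact hI' F hF p hp hdisc hcpt ι ρ hirr hunr hodd hHT h habs hmod
    · push Not at h
      obtain ⟨v, hv, χ₁, χ₂, h₁, h₂, h₃⟩ := h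
      exact hR' F hF p hp hdisc hcpt ι ρ hirr hunr hodd hHT ⟨v, hv, χ₁, χ₂, h₁, h₂, h₃⟩ habs hmod
  exact hC (hA hI hR)

end Summit.Langlands.Langlands.Theses.EmbeddingNecklace
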